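import Literature.Computability.MetaComplexity.NWPseudorandom
import Literature.Computability.Complexity.HardnessVsRandomness
import HarnessLib

/-!
# The Nisan–Wigderson generator in the polynomial regime: explicit polynomial designs
# (BFNW 1993 / IKW 2002, Thm. 11, the last step)

Literature / meta-complexity, companion of `NWPseudorandom.lean` (Arora–Barak Lemma 20.15 in parametric
circuit form, `prgAdvantage_nwGenerator_le`) and `NWGenerator.lean` (the explicit designs
`cikkDesign q n ℓ` of Carmosino–Impagliazzo–Kabanets–Kolokolova, Thm. 3.3: graphs of the polynomials of
degree `≤ ℓ` with `0/1` coefficients over `𝔽_q`, blocks of size `n ≤ q`, universe `q²`, pairwise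
intersections `≤ ℓ`). It records the instance of Lemma 20.15 that the POLYNOMIAL-HARDNESS regime of
hardness versus randomness uses — Babai–Fortnow–Nisan–Wigderson's "low end"
`EXP ⊄ P/poly ⟹ BPP ⊆ io-SUBEXP`, and the last step of Impagliazzo–Kabanets–Wigderson's Thm. 11
(`IKW2002_thm11` as recorded in `HardnessVsRandomness.lean`: a generator with `O(m²)` seed bits from an
`m`-variable table) —, where the number `N` of output bits is polynomial in the hardness and the design
must have LOGARITHMIC intersections `ℓ = ⌊log₂ N⌋ + 1` among `N` blocks, which the greedy designs over a
constant alphabet of the exponential regime (`NWLexicodeDesigns.lean`, `NWQuickPRG.lean`) do not give in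
polynomial time, and the algebraic designs do:

* `testBit_injective_of_lt` — block indices `i < N ≤ 2^ℓ` are told apart by their `ℓ` low bits, so
  `i ↦ cikkDesign q n ℓ (bits of i)` is an NW design with intersections `≤ ℓ`
  (`isNWDesign_cikkDesign_testBit`);
* **`fools_nwGenerator_cikkDesign`** — if `g : {0,1}ⁿ → {0,1}` has average-case hardness
  `H_avg(g) ≥ S` with `N · (N · univBound ℓ + N + 2) ≤ S`, then the NW generator of `g` over this design
  (seed `q²` bits, read through any enumeration `Fin k ≃ Fin (q·q)`) fools every `B₂`-circuit of size
  `≤ N` on `N` inputs with error `1/N`, i.e. it is `SIZE(N)`-pseudorandom (`isSizePseudorandom_nwGenerator_cikkDesign`);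
* `exists_prime_design_params` — for `n ≥ 1` the prime `q = leastPrimeGe n` has `n ≤ q ≤ 2n`, so the
  seed has `q² ≤ 4n²` bits (Bertrand; the `O(m²)` seed of IKW Thm. 11).

Everything is proved; no definitions. Nothing duplicates the tree (searched `cikkDesign`, `testBit_injective`,
`polynomial regime`: the exponential-regime instance is `isSizePseudorandom_genF` of `NWQuickPRG.lean`).

## References

* N. Nisan, A. Wigderson, *Hardness vs randomness*, JCSS 49 (1994) 149–167, Lemma 2.5 (designs from
  polynomials: "for every `m`, `log m ≤ n ≤ m`, there is an `(ℓ, n)`-design with `ℓ = O(n²)`"), Lemma 2.4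
  [NisanWigderson1994].
* L. Babai, L. Fortnow, N. Nisan, A. Wigderson, *BPP has subexponential time simulations unless EXPTIME
  has publishable proofs*, Comput. Complexity 3 (1993) 307–318, §3–4 (the low-end generator).
* R. Impagliazzo, V. Kabanets, A. Wigderson, *In search of an easy witness*, JCSS 65 (2002), Thm. 11
  [ImpagliazzoKabanetsWigderson2002].
* M. Carmosino, R. Impagliazzo, V. Kabanets, A. Kolokolova, *Learning algorithms from natural proofs*,
  CCC 2016, Thm. 3.3 [CarmosinoImpagliazzoKabanetsKolokolova2016].
* S. Arora, B. Barak, *Computational Complexity: A Modern Approach*, CUP 2009, Lemma 20.15, Thm. 20.6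
  [AroraBarakCC2009].
-/

noncomputable section

namespace Literature.Computability.MetaComplexity

open Finset Complexity

/-! ### Indexing blocks by the bits of their number -/

/-- Numbers below `2^ℓ` are determined by their `ℓ` low bits. [folklore] -/
theorem testBit_injective_of_lt {N ℓ : ℕ} (hN : N ≤ 2 ^ ℓ) :
    Function.Injective fun (i : Fin N) (c : Fin ℓ) => (i : ℕ).testBit c := by
  intro i j h
  apply Fin.ext
  apply Nat.eq_of_testBit_eq
  intro c
  by_cases hc : c < ℓ
  · exact congrFun h ⟨c, hc⟩
  · have hi : (i : ℕ) < 2 ^ c := lt_of_lt_of_le (lt_of_lt_of_le i.isLt hN)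
      (Nat.pow_le_pow_right (by norm_num) (not_lt.1 hc))
    have hj : (j : ℕ) < 2 ^ c := lt_of_lt_of_le (lt_of_lt_of_le j.isLt hN)
      (Nat.pow_le_pow_right (by norm_num) (not_lt.1 hc))
    rw [Nat.testBit_eq_false_of_lt hi, Nat.testBit_eq_false_of_lt hj]

/-- **The explicit design of the polynomial regime**: `N ≤ 2^ℓ` blocks of size `n ≤ q` in the universe
`Fin (q·q)`, block `i` being the graph of the polynomial with coefficient string "the bits of `i`", have
pairwise intersections `≤ ℓ`. [cite: NisanWigderson1994, Lemma 2.5] [cite: CarmosinoImpagliazzoKabanetsKolokolova2016, Thm. 3.3] -/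
theorem isNWDesign_cikkDesign_testBit (q n ℓ N : ℕ) [Fact q.Prime] (hn : n ≤ q) (hN : N ≤ 2 ^ ℓ) :
    IsNWDesign ℓ (fun i : Fin N => cikkDesign q n ℓ hn fun c : Fin ℓ => (i : ℕ).testBit c) :=
  (isNWDesign_cikkDesign q n ℓ hn).comp_injective (testBit_injective_of_lt hN)

/-! ### The NW generator over the explicit design fools polynomial-size circuits -/

/-- **The NW generator in the polynomial regime** (Nisan–Wigderson 1994, Lemma 2.4 with the designs of
Lemma 2.5; Arora–Barak Lemma 20.15): if `g : {0,1}ⁿ → {0,1}` has `H_avg(g) ≥ S` and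
`N · (N · univBound ℓ + N + 2) ≤ S`, `N ≤ 2^ℓ`, `n ≤ q` prime, then the generator
`s ↦ (g(s|_{e i}))_{i<N}` over the explicit design, the `q²` seed bits read through any enumeration `v`,
fools every `B₂`-circuit of size `≤ N` on `N` inputs with error `1/N`: the predictor of a size-`N`
distinguisher has size `≤ N + N · univBound ℓ + 2 ≤ S/N`. [cite: NisanWigderson1994, Lemma 2.4]
[cite: AroraBarakCC2009, Lemma 20.15] -/
theorem fools_nwGenerator_cikkDesign {q n ℓ N : ℕ} [Fact q.Prime] (hn : n ≤ q) (hN : 0 < N)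
    (hNℓ : N ≤ 2 ^ ℓ) (g : (Fin n → Bool) → Bool) {S : ℝ} (hg : AvgHardAtLeast g S)
    (hS : ((N * (N * univBound ℓ + N + 2) : ℕ) : ℝ) ≤ S) {k : ℕ} (v : Fin k ≃ Fin (q * q)) :
    Fools (fun s : Fin k → Bool =>
      nwGenerator (fun i : Fin N => cikkDesign q n ℓ hn fun c : Fin ℓ => (i : ℕ).testBit c) g (s ∘ v.symm))
      N (1 / N) := by
  intro C hB hs
  have hNR : (0 : ℝ) < N := by exact_mod_cast hN
  refine prgAdvantage_nwGenerator_le _ g (isNWDesign_cikkDesign_testBit q n ℓ N hn hNℓ) hg hN ?_ v C hB ?_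
  · -- `N ≤ (1/N) · S`, i.e. `N² ≤ S`
    rw [one_div, inv_mul_eq_div, le_div_iff₀ hNR]
    refine le_trans ?_ hS
    have : N * N ≤ N * (N * univBound ℓ + N + 2) := Nat.mul_le_mul_left _ (by omega)
    exact_mod_cast this
  · refine le_trans ?_ hS
    have h1 : C.size + N * univBound ℓ + 2 ≤ N * univBound ℓ + N + 2 := by omega
    have h2 : N * univBound ℓ + N + 2 ≤ N * (N * univBound ℓ + N + 2) := Nat.le_mul_of_pos_left _ hN
    exact_mod_cast h1.trans h2

/-- The same in the vocabulary of `HardnessVsRandomness.lean`: the generator is `SIZE(N)`-pseudorandom.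
[cite: ImpagliazzoKabanetsWigderson2002, §2.4 / Thm. 11] -/
theorem isSizePseudorandom_nwGenerator_cikkDesign {q n ℓ N : ℕ} [Fact q.Prime] (hn : n ≤ q) (hN : 0 < N)
    (hNℓ : N ≤ 2 ^ ℓ) (g : (Fin n → Bool) → Bool) {S : ℝ} (hg : AvgHardAtLeast g S)
    (hS : ((N * (N * univBound ℓ + N + 2) : ℕ) : ℝ) ≤ S) {k : ℕ} (v : Fin k ≃ Fin (q * q)) :
    IsSizePseudorandom (fun s : Fin k → Bool =>
      nwGenerator (fun i : Fin N => cikkDesign q n ℓ hn fun c : Fin ℓ => (i : ℕ).testBit c) g (s ∘ v.symm)) :=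
  fools_nwGenerator_cikkDesign hn hN hNℓ g hg hS v

/-- **The parameters of the design exist with a seed of `≤ 4n²` bits** (Bertrand's postulate): for
`n ≥ 1` the prime `q = leastPrimeGe n` satisfies `n ≤ q ≤ 2n`, hence `q² ≤ 4n²`.
[cite: NisanWigderson1994, Lemma 2.5] -/
theorem exists_prime_design_params (n : ℕ) (hn : 1 ≤ n) :
    n ≤ leastPrimeGe n ∧ (leastPrimeGe n).Prime ∧ leastPrimeGe n * leastPrimeGe n ≤ 4 * n ^ 2 := by
  obtain ⟨h1, h2⟩ := leastPrimeGe_spec n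
  have h3 := leastPrimeGe_le n (by omega)
  exact ⟨h1, h2, by nlinarith⟩

end Literature.Computability.MetaComplexity

end
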